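import Summits.QuantumFields.BalabanUV.Beta.GAN24.CapacitanceClosedFormEnlarged
import Summits.QuantumFields.BalabanUV.Beta.GAN24.EnlargedCapacitance
import Summits.QuantumFields.BalabanUV.Beta.GAN24.AliasFibreBridge
import Summits.QuantumFields.BalabanUV.Beta.GAN24.CapacitanceClosedFormAlias

/-!
# `BalabanUV.Beta.GAN24.CapacitanceClosedFormEnlargedFibre` — binder row G-an2-4 / (CONV-C), road P1-fibre, self-row Y10e* part 2 (the «(M2)/(M3) engine = alternative F3»
# of the L10 cut, OFF the (M4) critical path per gan24-p1-g2's ratification): leaf-06's ENLARGED CAPACITANCE SYSTEM `EnlargedCapacitance.EnlSolves` in CLOSED FORM, its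
# homogeneous INJECTIVITY from six scalar non-vanishings, and hence (U1) `det ≠ 0` at a COMPLEX quasi-momentum with NO `L₀ ≠ 0` and NO smallness

NOT IN PRINT; OUR PROOF ATTEMPT.  HONEST FRAMING (cell contract, verbatim): «discharging `BetaPertH` makes Bałaban's UV stability UNCONDITIONAL — a real
constructive-QFT result; it is NOT the continuum limit and NOT the Clay problem.»  HONEST DEPENDENCY (verbatim): «continuum YM on T⁴ ⇐ BetaPertH ∧ nine spine
estimates (0/9 proved); BetaPertH ⇐ (D1) ∧ (D4) ∧ CAP+tail; G-an2-4 gates asym, D1 and NE2/3/4.»  [folklore] finite-dimensional algebra over `ℂ` (no estimate, no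
cited fact, no wall binder, no `def … : Prop` fact).  NOT summit progress; nothing of (CONV-C)'s K-slot is discharged here; (I3′)/(U1) on a strip are NOT proved
here (the six non-vanishings are HYPOTHESES — at real `q` they hold `N`-uniformly by leaf-08-g6's `PinnedScalarBounds`/`PinnedScalarOmega`; on the strip they are open).

## What is proved
* §1 `enlData` (leaf-06's `EnlargedCapacitance.ZeroAlias` + `∂♭₀·∂₀ = L₀` + the good fibre's Y08f scalars `aDiag`/`sigma` + coarse symbols `δ, δ'` ↦ the coefficient data of
  `CapacitanceClosedFormEnlarged`); **`enlSolves_iff_enlBordered`** (under (T1)/(T2) of the GOOD fibre, leaf-06's `EnlSolves F z …` IS the bordered system `EnlBordered`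
  with sources `Q = q − srcQ`, `r = ρ + srcM` — leaf-15's `sum_wQ_Ablk`/`sum_wM_mublk` + Y08f's `sum_capP_mul`/`sum_capW_mul`/`capV_eq`); **`enlSolves_iff_closedForm`**
  (+ (T1₀)/(T2₀) and `ã_κ, wQ0_κ, wM0, wG0, σ̃, Ω ≠ 0`: `EnlSolves … A0 μ0 φ c ↔ (A0, μ0, φ, c) = (ACF, muCF, phiCF, cCF)`); the closed forms vanish at zero sources
  (`tCF_zero` … `ACF_zero`); **`enl_injective`** — the `hinj` hypothesis of leaf-06's (U1) socket, from the six non-vanishings alone.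
* §3 the CONCRETE alias fibre at every complex `p`: `zeroAliasZ p`, the telescoping identities `goodFibre_T1/T2`, `zeroAlias_T1/T2` (from `CapacitanceClosedFormAlias.sAl_mul_dAl`
  /`dbAl_mul_sbAl` + leaf-06's `AliasFibreBridge`), and **`det_trigPolySymbol_ne_zero_of_scalars`**: `hL′` (good aliases off the zero mode — `GoodAliasStrip.hL'_of_strip` on
  `Strip D κ`) ∧ `boxSs p 0 κ, boxS p 0, chiHat p 0 ≠ 0` ∧ `ã_κ, σ̃, Ω ≠ 0` ⇒ `det (trigPolySymbol (stencil (d+1)) pieceMatrix p) ≠ 0` (= the `hdet` binder of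
  `StripRegularPackaging`, pointwise).  Compare leaf-06's `ZeroAliasPinning.pinning_enl` (same socket, SMALLNESS near `p = 0` instead of the scalars).
* §4 consistency: `arrowSolves0_iff_enlArrow` (at `∂₀ = ∂♭₀ = 0`, `L₀ = 0` leaf-06's split system IS leaf-15's `ArrowSolves0`) and `arrowSolves_iff_enlArrow` (for an
  all-alias fibre — every `L_m ≠ 0` — `CapacitanceSolve.ArrowSolves` IS the split system at any `m₀`: `restrictNe`, `zeroAt`, `Fintype.sum_eq_add_sum_subtype_ne`).
Unit `b2b-balaban-gan24-formalise-leaf-02` (G-an2-4 formalisation swarm), 2026-08-20.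
-/

noncomputable section

open Finset
open scoped BigOperators
open Literature.MathematicalPhysics.QuantumFieldTheory.Balaban1983to89
open Literature.MathematicalPhysics.QuantumFieldTheory.Balaban1983to89.Beta
open Literature.Probability.LatticeModels (TorusSite)
open BlochFibreMatrix (stencil pieceMatrix)
open FibreInverseDecay (trigPolySymbol)

namespace Summit.QuantumFields.BalabanUV.Beta.GAN24.CapacitanceClosedFormEnlargedFibre

open FibreSymbols (dhat dflat lapSym)
open FibreBlockSolve (dot)
open FibreDFT (kFine)
open FibreArrow (chiHat sflat boxS boxSs dot_dflat_dhat)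
open AliasFibreBridge (sflat_eq_sbAl boxS_eq_SAl chiHat_eq_chiAl boxSs_eq_SAl_mul_sAl)
open CapacitanceClosedFormAlias (sAl_mul_dAl dbAl_mul_sbAl)
open CapacitanceSolve (Fibre capP capV capW srcQ srcM ELRows GRows MRow QRows ArrowSolves Ablk mublk sum_wQ_Ablk sum_wM_mublk Ablk_zero mublk_zero)
open CapacitanceClosedForm (hSum aDiag sigma sum_capP_mul sum_capW_mul capV_eq srcQ_zero srcM_zero)
open CapacitanceClosedFormEnlarged (EnlData EnlBordered aReg sReg Omega ACF muCF phiCF cCF UCF u1CF tCF U0 B1 BQ Bphi Psrc Kt Mt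
  enlBordered_iff_closedForm)
open EnlargedCapacitance (Good goodFibre zeroAlias EnlArrow EnlSolves enlArrow_iff det_trigPolySymbol_ne_zero_of_enl_injective)
open CapacitanceSolveZero (Fibre0 ArrowSolves0)

variable {D : ℕ} {ι : Type*} (F : Fibre D ι) (z : EnlargedCapacitance.ZeroAlias D)

/-! ## §1 leaf-06's enlarged capacitance system IS the enlarged bordered system of `CapacitanceClosedFormEnlarged` -/

/-- [folklore] The coefficient data of `CapacitanceClosedFormEnlarged.EnlBordered` from leaf-06's zero-alias data `z` (plus `∂♭₀·∂₀ = L₀`), the good fibre's capacitance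
scalars `aDiag F`, `sigma F` (Y08f), and the coarse symbols `δ, δ'`. -/
def enlData [Fintype ι] (hz : dot z.db0 z.dd0 = z.L0) (δ δ' : Fin D → ℂ) : EnlData D where
  dd0 := z.dd0
  db0 := z.db0
  L0 := z.L0
  wE0 := z.wE0
  wG0 := z.wG0
  wM0 := z.wM0
  wQ0 := z.wQ0
  dot_db0_dd0 := hz
  a' := aDiag F
  σ' := sigma F
  δ := δ
  δ' := δ'

/-- [folklore] **`EnlSolves ↔ EnlBordered`** under the telescoping identities (T1)/(T2) of the GOOD fibre: the Q/M rows of leaf-06's enlarged system, after leaf-15's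
`sum_wQ_Ablk`/`sum_wM_mublk`, are the structured rows (E4)/(E3) (`CapacitanceClosedForm.sum_capP_mul`/`sum_capW_mul`/`capV_eq`: diagonal plus longitudinal rank-one border),
with right-hand sides `Q = q − srcQ`, `r = ρ + srcM`. -/
theorem enlSolves_iff_enlBordered [Fintype ι] (hz : dot z.db0 z.dd0 = z.L0) (δ δ' : Fin D → ℂ) (hT1 : ∀ m κ, F.wQ m κ * F.dd m κ = F.wM m * δ κ)
    (hT2 : ∀ m κ, F.db m κ * F.wE m κ = F.wG m * δ' κ) (f : ι → Fin D → ℂ) (γ : ι → ℂ) (f0 : Fin D → ℂ) (γ0 ρ : ℂ) (q : Fin D → ℂ)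
    (A0 : Fin D → ℂ) (μ0 : ℂ) (φ : Fin D → ℂ) (c : ℂ) :
    EnlSolves F z f γ f0 γ0 ρ q A0 μ0 φ c ↔
      EnlBordered (enlData F z hz δ δ') (fun κ => q κ - srcQ F f γ κ) f0 γ0 (ρ + srcM F f) A0 μ0 φ c := by
  unfold EnlSolves EnlBordered
  simp only [sum_wQ_Ablk, sum_wM_mublk, sum_capP_mul F δ δ' hT1 hT2, sum_capW_mul F δ' hT2, capV_eq F δ hT1]
  constructor
  · rintro ⟨h1, h2, h4, h3⟩
    refine ⟨h1, h2, ?_, fun κ => ?_⟩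
    · show z.wM0 * μ0 - sigma F * dot δ' φ = ρ + srcM F f
      linear_combination h3
    · show z.wQ0 κ * A0 κ + aDiag F κ * φ κ - sigma F / 2 * δ κ * dot δ' φ + sigma F * δ κ * c = q κ - srcQ F f γ κ
      linear_combination h4 κ
  · rintro ⟨h1, h2, h3, h4⟩
    refine ⟨h1, h2, fun κ => ?_, ?_⟩
    · have h4' : z.wQ0 κ * A0 κ + aDiag F κ * φ κ - sigma F / 2 * δ κ * dot δ' φ + sigma F * δ κ * c = q κ - srcQ F f γ κ := h4 κ
      linear_combination h4'
    · have h3' : z.wM0 * μ0 - sigma F * dot δ' φ = ρ + srcM F f := h3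
      linear_combination h3'

/-- [folklore] **THE ENLARGED CAPACITANCE SYSTEM IN CLOSED FORM**: under (T1)/(T2) for the good fibre, (T1₀)/(T2₀) for the zero alias, and
`ã_κ, wQ0_κ, wM0, wG0, σ̃, Ω ≠ 0` — NO hypothesis on `L₀` — `EnlSolves … A0 μ0 φ c ↔ (A0, μ0, φ, c) = (ACF, muCF, phiCF, cCF)` of `CapacitanceClosedFormEnlarged`
at the sources `(q − srcQ, f0, γ0, ρ + srcM)`. -/
theorem enlSolves_iff_closedForm [Fintype ι] (hz : dot z.db0 z.dd0 = z.L0) (δ δ' : Fin D → ℂ) (hT1 : ∀ m κ, F.wQ m κ * F.dd m κ = F.wM m * δ κ)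
    (hT2 : ∀ m κ, F.db m κ * F.wE m κ = F.wG m * δ' κ) (hT10 : ∀ κ, z.wQ0 κ * z.dd0 κ = z.wM0 * δ κ) (hT20 : ∀ κ, z.db0 κ * z.wE0 κ = z.wG0 * δ' κ)
    (ha : ∀ κ, aReg (enlData F z hz δ δ').toZeroAlias (aDiag F) κ ≠ 0) (hQ : ∀ κ, z.wQ0 κ ≠ 0) (hM : z.wM0 ≠ 0) (hG : z.wG0 ≠ 0)
    (hσ : sReg (enlData F z hz δ δ').toZeroAlias (sigma F) ≠ 0) (hΩ : Omega (enlData F z hz δ δ').toZeroAlias (aDiag F) ≠ 0)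
    (f : ι → Fin D → ℂ) (γ : ι → ℂ) (f0 : Fin D → ℂ) (γ0 ρ : ℂ) (q : Fin D → ℂ) (A0 : Fin D → ℂ) (μ0 : ℂ) (φ : Fin D → ℂ) (c : ℂ) :
    EnlSolves F z f γ f0 γ0 ρ q A0 μ0 φ c ↔
      (A0 = ACF (enlData F z hz δ δ') (fun κ => q κ - srcQ F f γ κ) f0 γ0 (ρ + srcM F f)
        ∧ μ0 = muCF (enlData F z hz δ δ') (fun κ => q κ - srcQ F f γ κ) f0 γ0 (ρ + srcM F f)
        ∧ φ = phiCF (enlData F z hz δ δ') (fun κ => q κ - srcQ F f γ κ) f0 γ0 (ρ + srcM F f)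
        ∧ c = cCF (enlData F z hz δ δ') (fun κ => q κ - srcQ F f γ κ) f0 γ0 (ρ + srcM F f)) := by
  rw [enlSolves_iff_enlBordered F z hz δ δ' hT1 hT2]
  exact enlBordered_iff_closedForm (enlData F z hz δ δ') _ f0 γ0 _ hT10 hT20 ha hQ hM hG hσ hΩ A0 μ0 φ c

/-- [folklore] With zero sources every closed form vanishes: `tCF = 0`. -/
theorem tCF_zero (E : EnlData D) : tCF E 0 0 0 0 = 0 := by
  simp [tCF, Kt, U0, BQ, Bphi, B1, Psrc]

/-- [folklore] … `UCF = 0`. -/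
theorem UCF_zero (E : EnlData D) : UCF E 0 0 0 0 = 0 := by
  simp [UCF, tCF_zero, U0]

/-- [folklore] … `cCF = 0`. -/
theorem cCF_zero (E : EnlData D) : cCF E 0 0 0 0 = 0 := by
  simp [cCF, tCF_zero]

/-- [folklore] … `phiCF = 0`. -/
theorem phiCF_zero (E : EnlData D) : phiCF E 0 0 0 0 = 0 := by
  funext κ; simp [phiCF, UCF_zero, Psrc]

/-- [folklore] … `u1CF = 0`. -/
theorem u1CF_zero (E : EnlData D) : u1CF E 0 0 0 0 = 0 := by
  simp [u1CF, UCF_zero, B1, Psrc]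

/-- [folklore] … `muCF = 0`. -/
theorem muCF_zero (E : EnlData D) : muCF E 0 0 0 0 = 0 := by
  simp [muCF, u1CF_zero]

/-- [folklore] … `ACF = 0`. -/
theorem ACF_zero (E : EnlData D) : ACF E 0 0 0 0 = 0 := by
  funext κ; simp [ACF, phiCF_zero, u1CF_zero, cCF_zero]

/-- [folklore] **THE HOMOGENEOUS ENLARGED CAPACITANCE SYSTEM IS INJECTIVE** under (T1)/(T2), (T1₀)/(T2₀) and `ã_κ, wQ0_κ, wM0, wG0, σ̃, Ω ≠ 0` — the hypothesis
`hinj` of leaf-06's (U1) socket `det_trigPolySymbol_ne_zero_of_enl_injective`, with NO smallness, NO `L₀ ≠ 0` and NO determinant. -/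
theorem enl_injective [Fintype ι] (hz : dot z.db0 z.dd0 = z.L0) (δ δ' : Fin D → ℂ) (hT1 : ∀ m κ, F.wQ m κ * F.dd m κ = F.wM m * δ κ)
    (hT2 : ∀ m κ, F.db m κ * F.wE m κ = F.wG m * δ' κ) (hT10 : ∀ κ, z.wQ0 κ * z.dd0 κ = z.wM0 * δ κ) (hT20 : ∀ κ, z.db0 κ * z.wE0 κ = z.wG0 * δ' κ)
    (ha : ∀ κ, aReg (enlData F z hz δ δ').toZeroAlias (aDiag F) κ ≠ 0) (hQ : ∀ κ, z.wQ0 κ ≠ 0) (hM : z.wM0 ≠ 0) (hG : z.wG0 ≠ 0)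
    (hσ : sReg (enlData F z hz δ δ').toZeroAlias (sigma F) ≠ 0) (hΩ : Omega (enlData F z hz δ δ').toZeroAlias (aDiag F) ≠ 0)
    (A0 : Fin D → ℂ) (μ0 : ℂ) (φ : Fin D → ℂ) (c : ℂ) (h : EnlSolves F z 0 0 0 0 0 0 A0 μ0 φ c) : A0 = 0 ∧ μ0 = 0 ∧ φ = 0 ∧ c = 0 := by
  obtain ⟨hA0, hμ0, hφ, hc⟩ := (enlSolves_iff_closedForm F z hz δ δ' hT1 hT2 hT10 hT20 ha hQ hM hG hσ hΩ 0 0 0 0 0 0 A0 μ0 φ c).1 h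
  have hQ0 : (fun κ => (0 : Fin D → ℂ) κ - srcQ F 0 0 κ) = 0 := by funext κ; simp [srcQ_zero]
  have hr0 : (0 : ℂ) + srcM F 0 = 0 := by rw [srcM_zero, add_zero]
  rw [hQ0, hr0] at hA0 hμ0 hφ hc
  rw [ACF_zero] at hA0
  rw [muCF_zero] at hμ0
  rw [phiCF_zero] at hφ
  rw [cCF_zero] at hc
  exact ⟨hA0, hμ0, hφ, hc⟩

/-! ## §3 The alias fibre at COMPLEX quasi-momentum: (U1) from six scalar non-vanishings (via leaf-06's socket) -/

section Alias

variable {N : ℕ} [NeZero N]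

/-- [folklore] The concrete zero-alias data at `p` as `CapacitanceClosedFormEnlarged.ZeroAlias` (leaf-06's `zeroAlias p` plus `∂♭₀·∂₀ = L₀`). -/
def zeroAliasZ (p : Fin D → ℂ) : CapacitanceClosedFormEnlarged.ZeroAlias D :=
  ⟨(zeroAlias (N := N) p).dd0, (zeroAlias (N := N) p).db0, (zeroAlias (N := N) p).L0, (zeroAlias (N := N) p).wE0, (zeroAlias (N := N) p).wG0,
    (zeroAlias (N := N) p).wM0, (zeroAlias (N := N) p).wQ0, dot_dflat_dhat _⟩

/-- [folklore] `∂♭₀·∂₀ = L₀` for the concrete zero alias. -/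
theorem dot_zeroAlias (p : Fin D → ℂ) : dot (zeroAlias (N := N) p).db0 (zeroAlias (N := N) p).dd0 = (zeroAlias (N := N) p).L0 :=
  dot_dflat_dhat _

/-- [folklore] (T1) FOR THE GOOD FIBRE AT EVERY COMPLEX `p`: `boxSs p m κ · ∂̂_κ(k_m) = boxS p m · ∂̂_κ(p)` (the geometric-sum identity `sAl_mul_dAl` of
`CapacitanceClosedFormAlias` + leaf-06's bridges `boxSs_eq_SAl_mul_sAl`/`boxS_eq_SAl`). -/
theorem goodFibre_T1 (p : Fin D → ℂ) (hL' : ∀ m : Good D N, lapSym (kFine p m.1) ≠ 0) (m : Good D N) (κ : Fin D) :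
    (goodFibre p hL').wQ m κ * (goodFibre p hL').dd m κ = (goodFibre p hL').wM m * dhat p κ := by
  show boxSs p m.1 κ * dhat (kFine p m.1) κ = boxS p m.1 * dhat p κ
  rw [boxSs_eq_SAl_mul_sAl, boxS_eq_SAl, mul_assoc]
  exact congrArg _ (sAl_mul_dAl N p m.1 κ)

/-- [folklore] (T2) FOR THE GOOD FIBRE AT EVERY COMPLEX `p`: `∂̂♭_κ(k_m) · (χ̂_m s♭_κ(m)) = χ̂_m · ∂̂♭_κ(p)`. -/
theorem goodFibre_T2 (p : Fin D → ℂ) (hL' : ∀ m : Good D N, lapSym (kFine p m.1) ≠ 0) (m : Good D N) (κ : Fin D) :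
    (goodFibre p hL').db m κ * (goodFibre p hL').wE m κ = (goodFibre p hL').wG m * dflat p κ := by
  show dflat (kFine p m.1) κ * (chiHat p m.1 * sflat p m.1 κ) = chiHat p m.1 * dflat p κ
  rw [sflat_eq_sbAl, mul_left_comm]
  exact congrArg _ (dbAl_mul_sbAl N p m.1 κ)

/-- [folklore] (T1₀) for the concrete zero alias at every complex `p`. -/
theorem zeroAlias_T1 (p : Fin D → ℂ) (κ : Fin D) :
    (zeroAliasZ (N := N) p).wQ0 κ * (zeroAliasZ (N := N) p).dd0 κ = (zeroAliasZ (N := N) p).wM0 * dhat p κ := by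
  show boxSs p (0 : TorusSite D N) κ * dhat (kFine p (0 : TorusSite D N)) κ = boxS p (0 : TorusSite D N) * dhat p κ
  rw [boxSs_eq_SAl_mul_sAl, boxS_eq_SAl, mul_assoc]
  exact congrArg _ (sAl_mul_dAl N p 0 κ)

/-- [folklore] (T2₀) for the concrete zero alias at every complex `p`. -/
theorem zeroAlias_T2 (p : Fin D → ℂ) (κ : Fin D) :
    (zeroAliasZ (N := N) p).db0 κ * (zeroAliasZ (N := N) p).wE0 κ = (zeroAliasZ (N := N) p).wG0 * dflat p κ := by
  show dflat (kFine p (0 : TorusSite D N)) κ * (chiHat p (0 : TorusSite D N) * sflat p (0 : TorusSite D N) κ) = chiHat p (0 : TorusSite D N) * dflat p κ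
  rw [sflat_eq_sbAl, mul_left_comm]
  exact congrArg _ (dbAl_mul_sbAl N p 0 κ)

/-- [folklore] **(U1) AT A COMPLEX QUASI-MOMENTUM FROM SIX SCALAR NON-VANISHINGS** (road (M3)/«alternative F3» of L10): if every good alias is off the zero mode
(`hL′`, e.g. leaf-06's `GoodAliasStrip.hL'_of_strip` on `Strip D κ`), the zero alias's box weights `boxSs p 0 κ`, `boxS p 0`, `χ̂_0 = chiHat p 0` do not vanish, and the
three REGULARISED scalars `ã_κ`, `σ̃`, `Ω` of `CapacitanceClosedFormEnlarged` (built from the good fibre's `aDiag`/`sigma`) do not vanish, then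
`det (trigPolySymbol (stencil (d+1)) pieceMatrix p) ≠ 0` — NO `L₀ ≠ 0`, NO smallness: valid across the null cone and at `p = 0`. -/
theorem det_trigPolySymbol_ne_zero_of_scalars {d : ℕ} (p : Fin (d + 1) → ℂ) (hL' : ∀ m : Good (d + 1) N, lapSym (kFine p m.1) ≠ 0)
    (ha : ∀ κ, aReg (zeroAliasZ (N := N) p) (aDiag (goodFibre p hL')) κ ≠ 0) (hQ : ∀ κ, boxSs p (0 : TorusSite (d + 1) N) κ ≠ 0)
    (hM : boxS p (0 : TorusSite (d + 1) N) ≠ 0) (hG : chiHat p (0 : TorusSite (d + 1) N) ≠ 0)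
    (hσ : sReg (zeroAliasZ (N := N) p) (sigma (goodFibre p hL')) ≠ 0) (hΩ : Omega (zeroAliasZ (N := N) p) (aDiag (goodFibre p hL')) ≠ 0) :
    (trigPolySymbol (stencil (d + 1)) (pieceMatrix (N := N)) p).det ≠ 0 :=
  det_trigPolySymbol_ne_zero_of_enl_injective p hL' fun A0 μ0 φ c h =>
    enl_injective (goodFibre p hL') (zeroAlias p) (dot_zeroAlias p) (dhat p) (dflat p) (goodFibre_T1 p hL') (goodFibre_T2 p hL')
      (zeroAlias_T1 p) (zeroAlias_T2 p) ha hQ hM hG hσ hΩ A0 μ0 φ c h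

end Alias

/-! ## §4 Consistency with the two landed special cases of the split arrow system -/

/-- [folklore] leaf-15's `p = 0` data as zero-alias data with VANISHING symbols (`∂₀ = ∂♭₀ = 0`, `L₀ = 0`). -/
def zeroOfFibre0 (F0 : Fibre0 D ι) : EnlargedCapacitance.ZeroAlias D :=
  ⟨0, 0, 0, F0.wE0, F0.wG0, F0.wM0, F0.wQ0⟩

/-- [folklore] **AT `p = 0` leaf-06's split arrow system IS leaf-15's `ArrowSolves0`** (the zero EL rows collapse to `−wE0_κ φ_κ = f0_κ`, the G row to `−wG0 c = γ0`). -/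
theorem arrowSolves0_iff_enlArrow [Fintype ι] (F0 : Fibre0 D ι) (f : ι → Fin D → ℂ) (γ : ι → ℂ) (f0 : Fin D → ℂ) (γ0 ρ : ℂ) (q : Fin D → ℂ)
    (A : ι → Fin D → ℂ) (μ : ι → ℂ) (A0 : Fin D → ℂ) (μ0 : ℂ) (φ : Fin D → ℂ) (c : ℂ) :
    ArrowSolves0 F0 f γ f0 γ0 ρ q A μ A0 μ0 φ c ↔ EnlArrow F0.toFibre (zeroOfFibre0 F0) f γ f0 γ0 ρ q A μ A0 μ0 φ c := by
  unfold ArrowSolves0 EnlArrow zeroOfFibre0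
  simp

section AllAliases

variable [DecidableEq ι] (Fall : Fibre D ι) (m₀ : ι)

/-- [folklore] The other aliases of an all-alias fibre (every `L_m ≠ 0`) as a fibre over `{m // m ≠ m₀}`. -/
def restrictNe : Fibre D {m : ι // m ≠ m₀} :=
  ⟨fun m => Fall.dd m, fun m => Fall.db m, fun m => Fall.L m, fun m => Fall.wE m, fun m => Fall.wG m, fun m => Fall.wM m,
    fun m => Fall.wQ m, fun m => Fall.L_ne m, fun m => Fall.dot_db_dd m⟩

/-- [folklore] The alias `m₀` of an all-alias fibre as zero-alias data (here `L₀ = L_{m₀} ≠ 0`: the generic case OFF the cone). -/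
def zeroAt : EnlargedCapacitance.ZeroAlias D :=
  ⟨Fall.dd m₀, Fall.db m₀, Fall.L m₀, Fall.wE m₀, Fall.wG m₀, Fall.wM m₀, Fall.wQ m₀⟩

/-- [folklore] Splitting a family of conditions over `ι` at `m₀`. -/
theorem forall_iff_and_subtype (P : ι → Prop) : (∀ m, P m) ↔ P m₀ ∧ ∀ m : {m : ι // m ≠ m₀}, P m := by
  constructor
  · exact fun h => ⟨h m₀, fun m => h m⟩
  · rintro ⟨h0, h'⟩ m
    by_cases hm : m = m₀
    · rw [hm]; exact h0
    · exact h' ⟨m, hm⟩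

/-- [folklore] **OFF THE CONE THE SPLIT SYSTEM IS A RE-BRACKETING OF `CapacitanceSolve.ArrowSolves`**: for an all-alias fibre (every `L_m ≠ 0`) the arrow system is
leaf-06's split system of (`restrictNe`, `zeroAt`) with the unknowns/sources of `m₀` separated (`Fintype.sum_eq_add_sum_subtype_ne`) — so wherever Y08f's closed form
applies, the enlarged closed form solves the SAME system, with no `1/L_{m₀}`. -/
theorem arrowSolves_iff_enlArrow [Fintype ι] (f : ι → Fin D → ℂ) (γ : ι → ℂ) (ρ : ℂ) (q : Fin D → ℂ) (A : ι → Fin D → ℂ) (μ : ι → ℂ) (φ : Fin D → ℂ) (c : ℂ) :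
    ArrowSolves Fall f γ ρ q A μ φ c ↔
      EnlArrow (restrictNe Fall m₀) (zeroAt Fall m₀) (fun m => f m) (fun m => γ m) (f m₀) (γ m₀) ρ q
        (fun m => A m) (fun m => μ m) (A m₀) (μ m₀) φ c := by
  unfold ArrowSolves EnlArrow ELRows GRows MRow QRows restrictNe zeroAt
  rw [forall_iff_and_subtype m₀ (fun m => ∀ κ, _), forall_iff_and_subtype m₀ (fun m => Fall.L m * dot (Fall.db m) (A m) - Fall.wG m * c = γ m),
    Fintype.sum_eq_add_sum_subtype_ne _ m₀]
  simp only [Fintype.sum_eq_add_sum_subtype_ne (fun m => Fall.wQ m _ * A m _) m₀]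
  tauto

end AllAliases

end Summit.QuantumFields.BalabanUV.Beta.GAN24.CapacitanceClosedFormEnlargedFibre

end
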